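import Literature.NumberTheory.GaloisRepresentations.SemiLocalUnits
import Literature.NumberTheory.GaloisRepresentations.LocalWeilDatum
import Mathlib.FieldTheory.PrimitiveElement
import Mathlib.FieldTheory.Galois.Infinite
import Mathlib.Analysis.SpecificLimits.Normed
import HarnessLib

/-!
# Completions of a Galois extension above `v` and the compositum `K_v(E) ⊆ K̄_v`
# (Cassels–Fröhlich II §10, VII §1.1: `E ⊗_K K_v ≅ ∏_{w∣v} E_w`, `G_w ≅ Gal(E_w/K_v)`)

Topic `NumberTheory/GaloisRepresentations` (the local–global dictionary for a finite Galois extension of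
number fields); namespace `Literature.NumberTheory.GaloisRepresentations.SemiLocal`, continuing
`SemiLocalUnits.lean` (`SemiLocal K E v = ∏_{w∣v} E_w` with its `Gal(E/K)`-action and the normal basis
`E ⊗_K K_v ≅ ∏_{w∣v} E_w`).  Proof file: theorems only (the scalar tower `K → K_v → E_w` and the
finite-dimensionality of `E_w` over `K_v` are stated as theorems and used through `haveI`); no
definition, no instance, no named fact (D-0026).

Let `E/K` be a finite Galois extension of number fields with group `G`, `v` a finite place of `K`,
`K_v = v.adicCompletion K`, `K̄_v` its algebraic closure with `Γ_{K_v} = Gal(K̄_v/K_v)`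
(`Field.absoluteGaloisGroup`), and `K̄ → K̄_v` the tree's chosen `K`-embedding
(`absClosureEmbedding K K_v`, with the restriction `absGaloisRestrict K K_v : Γ_{K_v} → Γ_K`).  For a
`K`-embedding `ιE : E → K̄` let `K_v(E) ⊆ K̄_v` be the field generated over `K_v` by the image of `E`
(the *compositum*, Cassels–Fröhlich II §10: "`L_w = K_v L`").  Classically (op. cit. II §10 Thm.,
VII §1.1 and Prop. 1.2): `E ⊗_K K_v ≅ ∏_{w ∣ v} E_w`; the embedding `E → K̄_v` extends to exactly one
factor `E_{w₀}`, identifying `K_v(E)` with `E_{w₀}`; and `Γ_{K_v} → G`, `d ↦ d|_E`, maps onto the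
decomposition group `G_{w₀}` with kernel `Gal(K̄_v/K_v(E))`, so `G_{w₀} ≅ Gal(E_{w₀}/K_v)`.  This file
proves these statements in the tree's language:

* `span_range_diag_eq_top`, `linearIndependent_diag_comp_basis`, `finrank_eq` — the diagonal image of
  **any** `K`-basis of `E` is a `K_v`-basis of `∏_{w∣v} E_w` (from the normal basis of
  `SemiLocalUnits`), `dim_{K_v} ∏ E_w = [E:K]`; `span_range_coe_eq_top` — `E` spans each `E_w` over
  `K_v`; `finrank_place_eq_card_stabilizer` — **`[E_w : K_v] = #G_w`**.
* `place_eq_of_algHom` — **rigidity**: a `K_v`-algebra map `E_{w₁} → E_{w₂}` which is the identity on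
  `E` forces `w₁ = w₂` (it is continuous, being `K_v`-linear between finite-dimensional spaces over the
  complete field `K_v`, and `eᵏ → 0` in `E_{w₁}` but `|eᵏ|_{w₂} = 1` for `e ∈ 𝔭_{w₁} ∖ 𝔭_{w₂}`).
* `exists_place_algHom_compositum`, `bijective_algHom_compositum`, `finrank_compositum_eq` — **there are
  a place `w₀ ∣ v` and a `K_v`-isomorphism `θ : K_v(E) ≅ E_{w₀}` restricting to the identity of `E`**
  (for the generator `α` of a power basis of `E/K`, the minimal polynomial over `K_v` of the image of
  `α` has the root `α` in some `E_w`, else its cofactor in `minpoly_K α`, of degree `< [E:K]`, would kill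
  `diag α`; then `θ` is Mathlib's `algHomAdjoinIntegralEquiv`, and it is onto because `E` spans `E_w`).
* `exists_restrict`, `smul_comp_apply`, `smul_mem_compositum` — `d ∈ Γ_{K_v}` restricts to `g ∈ G`
  (`E/K` normal), acts on the image of `E` through `g`, and preserves `K_v(E)`;
  `smul_place_eq` — **`g ∈ G_{w₀}`** (rigidity applied to `g_* ∘ θ ∘ d⁻¹ ∘ θ⁻¹ : E_{w₀} → E_{g w₀}`);
  `algHom_compositum_smul` — **equivariance `θ(d • x) = g_*(θ x)`** (`g_* = galAdicCompletionMap g`);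
  `restrict_eq_one_iff` — the kernel of `d ↦ g` is `Gal(K̄_v/K_v(E)) = galFixing K_v (K_v(E))`;
  `exists_restrict_eq_of_smul_place_eq` — **`Γ_{K_v} → G_{w₀}` is surjective** (its image has order
  `[Γ_{K_v} : Gal(K̄_v/K_v(E))] = [K_v(E) : K_v] = [E_{w₀} : K_v] = #G_{w₀}`).

These are the inputs for turning "`a ∈ K` is a norm from `K_v(E)`" (the output of the cyclic
cohomology `κ(a) = 0` over `Γ_{K_v}`) into "`(a)_v` is the Galois norm of an element of
`∏_{w∣v} E_wˣ`" (the input of the idelic Hasse norm theorem), towards the Hasse principle for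
`H²(K, K̄ˣ)` and `Literature.NumberTheory.EllipticCurves.Cassels1962_index_eq_period_of_mem_sha`.

## References

* J. W. S. Cassels, A. Fröhlich (eds.), *Algebraic Number Theory* (1967), Ch. II (Cassels, *Global
  fields*) §10 Theorem and §11, Ch. VII (Tate) §1.1, Prop. 1.2. [CasselsFrohlichANT1967]
* J. Neukirch, *Algebraic Number Theory*, Springer 1999, Ch. II §8 (8.1)–(8.4) (extensions of
  valuations and embeddings into `K̄_v`). [NeukirchANT1999]
-/

noncomputable section

open NumberField IsDedekindDomain IntermediateField Polynomial
open scoped Valued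

namespace Literature.NumberTheory.GaloisRepresentations

namespace SemiLocal

open Literature.NumberTheory.Automorphic

universe u

variable {K : Type u} [Field K] [NumberField K] {E : Type u} [Field E] [NumberField E] [Algebra K E]
variable {v : HeightOneSpectrum (𝓞 K)}

/-! ### `K → K_v → E_w` is a scalar tower -/

/-- `K → K_v → E_w` commutes with `K → E → E_w` (a theorem, used through `haveI`). [folklore] -/
theorem isScalarTower_place (w : Place K E v) :
    IsScalarTower K (v.adicCompletion K) ((w : HeightOneSpectrum (𝓞 E)).adicCompletion E) :=
  IsScalarTower.of_algebraMap_eq fun x => by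
    rw [algebraMap_place_eq, show algebraMap K (v.adicCompletion K) x = (x : v.adicCompletion K) from rfl,
      adicCompletionOfLiesOver_coe, IsScalarTower.algebraMap_apply K E]
    rfl

/-! ### Any `K`-basis of `E` is a `K_v`-basis of `∏_{w ∣ v} E_w` -/

section AnyBasis

variable [IsGalois K E]

/-- The `K_v`-span of the diagonal image of `E` is all of `∏_{w ∣ v} E_w`. [cite: CasselsFrohlichANT1967, Ch. II §10] -/
theorem span_range_diag_eq_top :
    Submodule.span (v.adicCompletion K) (Set.range (diag K E v)) = ⊤ := by
  refine eq_top_iff.mpr (span_diag_normalBasis_eq_top.ge.trans (Submodule.span_mono ?_))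
  rintro _ ⟨g, rfl⟩
  exact ⟨_, rfl⟩

/-- `dim_{K_v} ∏_{w ∣ v} E_w = [E : K]`. [cite: CasselsFrohlichANT1967, Ch. II §10] -/
theorem finrank_eq : Module.finrank (v.adicCompletion K) (SemiLocal K E v) = Module.finrank K E := by
  rw [Module.finrank_eq_card_basis (basis K E v), ← Nat.card_eq_fintype_card, IsGalois.card_aut_eq_finrank]

/-- **The diagonal image of any `K`-basis of `E` is a `K_v`-basis of `∏_{w ∣ v} E_w`** (it spans,
by `span_range_diag_eq_top`, and has the right cardinality). [cite: CasselsFrohlichANT1967, Ch. II §10] -/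
theorem linearIndependent_diag_comp_basis {ι : Type*} [Fintype ι] (b : Module.Basis ι K E) :
    LinearIndependent (v.adicCompletion K) (fun i => diag K E v (b i)) := by
  classical
  apply linearIndependent_of_top_le_span_of_card_eq_finrank
  · -- spanning: the span contains `diag x` for every `x`
    rw [top_le_iff, eq_top_iff, ← span_range_diag_eq_top, Submodule.span_le]
    rintro _ ⟨x, rfl⟩
    rw [← b.sum_repr x, map_sum]
    refine Submodule.sum_mem _ fun i _ => ?_
    rw [diag_smul]
    exact Submodule.smul_mem _ _ (Submodule.subset_span ⟨i, rfl⟩)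
  · rw [finrank_eq, Module.finrank_eq_card_basis b]

/-- The `K_v`-span of the image of `E` in a single completion `E_w` is all of `E_w`
(projection of `span_range_diag_eq_top`). [folklore] -/
theorem span_range_coe_eq_top (w : Place K E v) :
    Submodule.span (v.adicCompletion K)
      (Set.range (algebraMap E ((w : HeightOneSpectrum (𝓞 E)).adicCompletion E))) = ⊤ := by
  classical
  set π := LinearMap.proj (R := v.adicCompletion K)
    (φ := fun w : Place K E v => (w : HeightOneSpectrum (𝓞 E)).adicCompletion E) w with hπ
  have hproj : Function.Surjective π := fun x => ⟨Pi.single w x, by simp [hπ]⟩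
  have h1 : Submodule.map π ⊤ = ⊤ := by rw [Submodule.map_top, LinearMap.range_eq_top.mpr hproj]
  rw [← span_range_diag_eq_top, Submodule.map_span] at h1
  rw [← h1]
  congr 1
  ext y
  constructor
  · rintro ⟨x, rfl⟩
    exact ⟨diag K E v x, ⟨x, rfl⟩, rfl⟩
  · rintro ⟨_, ⟨x, rfl⟩, rfl⟩
    exact ⟨x, rfl⟩

/-- Each completion `E_w` is finite-dimensional over `K_v` (a theorem, used through `haveI`).
[folklore] -/
theorem finiteDimensional_place (w : Place K E v) :
    FiniteDimensional (v.adicCompletion K) ((w : HeightOneSpectrum (𝓞 E)).adicCompletion E) := by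
  classical
  exact Module.Finite.of_surjective
    (LinearMap.proj (R := v.adicCompletion K)
      (φ := fun w : Place K E v => (w : HeightOneSpectrum (𝓞 E)).adicCompletion E) w)
    fun x => ⟨Pi.single w x, by simp⟩

omit [IsGalois K E] in
/-- `Gal(E/F)` transports completions `K_v`-linearly: `dim_{K_v} E_{σ w} = dim_{K_v} E_w`. [folklore] -/
theorem finrank_place_smul (σ : E ≃ₐ[K] E) (w : Place K E v) :
    Module.finrank (v.adicCompletion K) (((σ • w : Place K E v) : HeightOneSpectrum (𝓞 E)).adicCompletion E) =
      Module.finrank (v.adicCompletion K) ((w : HeightOneSpectrum (𝓞 E)).adicCompletion E) := by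
  let e : ((w : HeightOneSpectrum (𝓞 E)).adicCompletion E) ≃ₗ[v.adicCompletion K]
      (((σ • w : Place K E v) : HeightOneSpectrum (𝓞 E)).adicCompletion E) :=
    { (galAdicCompletionEquiv (L := E) σ (Place.smul_coe σ w)).toAddEquiv with
      map_smul' := fun c x => by
        change galAdicCompletionMap σ (Place.smul_coe σ w) (c • x) = c • galAdicCompletionMap σ _ x
        rw [Algebra.smul_def, Algebra.smul_def, map_mul]
        congr 1
        exact galAdicCompletionMap_adicCompletionOfLiesOver K σ v (Place.smul_coe σ w) c }
  exact e.finrank_eq.symm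

/-- **`[E_w : K_v] = #Stab(w)`**: the local degree is the order of the decomposition group
(`∑_w [E_w : K_v] = [E : K] = #{w ∣ v} · #G_w`, all local degrees above `v` being equal).
[cite: CasselsFrohlichANT1967, Ch. VII §1.1–1.2] -/
theorem finrank_place_eq_card_stabilizer (w : Place K E v) :
    Module.finrank (v.adicCompletion K) ((w : HeightOneSpectrum (𝓞 E)).adicCompletion E) =
      Nat.card (MulAction.stabilizer (E ≃ₐ[K] E) w) := by
  classical
  -- all local degrees are equal
  have heq : ∀ w' : Place K E v,
      Module.finrank (v.adicCompletion K) ((w' : HeightOneSpectrum (𝓞 E)).adicCompletion E) =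
        Module.finrank (v.adicCompletion K) ((w : HeightOneSpectrum (𝓞 E)).adicCompletion E) := by
    intro w'
    obtain ⟨σ, rfl⟩ := Place.exists_smul_eq w w'
    exact finrank_place_smul σ w
  haveI : ∀ w' : Place K E v,
      FiniteDimensional (v.adicCompletion K) ((w' : HeightOneSpectrum (𝓞 E)).adicCompletion E) :=
    fun w' => finiteDimensional_place w'
  have hsum : Module.finrank (v.adicCompletion K) (SemiLocal K E v) =
      Fintype.card (Place K E v) *
        Module.finrank (v.adicCompletion K) ((w : HeightOneSpectrum (𝓞 E)).adicCompletion E) := by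
    rw [Module.finrank_pi_fintype, Finset.sum_congr rfl fun w' _ => heq w', Finset.sum_const,
      Finset.card_univ, smul_eq_mul]
  have horb : Fintype.card (Place K E v) * Nat.card (MulAction.stabilizer (E ≃ₐ[K] E) w) =
      Nat.card (E ≃ₐ[K] E) := by
    rw [← Subgroup.index_mul_card (MulAction.stabilizer (E ≃ₐ[K] E) w), MulAction.index_stabilizer,
      ← Nat.card_eq_fintype_card]
    congr 1
    have horb : MulAction.orbit (E ≃ₐ[K] E) w = Set.univ := by
      refine Set.eq_univ_of_forall fun w' => ?_
      obtain ⟨σ, rfl⟩ := Place.exists_smul_eq w w'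
      exact MulAction.mem_orbit w σ
    rw [horb, Set.ncard_univ, Nat.card_eq_fintype_card]
  have hG : Nat.card (E ≃ₐ[K] E) = Module.finrank (v.adicCompletion K) (SemiLocal K E v) := by
    rw [finrank_eq, IsGalois.card_aut_eq_finrank]
  have hpos : 0 < Fintype.card (Place K E v) := Fintype.card_pos
  rw [hG, hsum] at horb
  exact (Nat.eq_of_mul_eq_mul_left hpos horb).symm

end AnyBasis

/-! ### Rigidity: a `K_v`-algebra map `E_{w₁} → E_{w₂}` over `E` forces `w₁ = w₂` -/

section Rigidity

variable [IsGalois K E]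

/-- **Rigidity of completions**: if a `K_v`-algebra homomorphism `Θ : E_{w₁} → E_{w₂}` restricts to
the identity of `E`, then `w₁ = w₂`.  (Such a `Θ` is `K_v`-linear between finite-dimensional spaces
over the complete field `K_v`, hence continuous; for `e ∈ 𝔭_{w₁} ∖ 𝔭_{w₂}` the powers `eᵏ` tend to
`0` in `E_{w₁}` but have absolute value `1` in `E_{w₂}`.) [folklore] -/
theorem place_eq_of_algHom {w₁ w₂ : Place K E v}
    (Θ : ((w₁ : HeightOneSpectrum (𝓞 E)).adicCompletion E) →ₐ[v.adicCompletion K]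
      ((w₂ : HeightOneSpectrum (𝓞 E)).adicCompletion E))
    (hΘ : ∀ e : E, Θ (e : (w₁ : HeightOneSpectrum (𝓞 E)).adicCompletion E) = e) : w₁ = w₂ := by
  by_contra hne
  have hne' : (w₁ : HeightOneSpectrum (𝓞 E)) ≠ w₂ := fun h => hne (Place.ext h)
  -- an integer in `𝔭_{w₁}` but not in `𝔭_{w₂}`
  have hP : ¬ (w₁ : HeightOneSpectrum (𝓞 E)).asIdeal ≤ (w₂ : HeightOneSpectrum (𝓞 E)).asIdeal := by
    intro hle
    exact hne' (HeightOneSpectrum.ext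
      ((w₁ : HeightOneSpectrum (𝓞 E)).isMaximal.eq_of_le (w₂ : HeightOneSpectrum (𝓞 E)).isPrime.ne_top
        hle))
  obtain ⟨r, hr₁, hr₂⟩ := Set.not_subset.mp hP
  set e : E := algebraMap (𝓞 E) E r with he
  have hv₁ : Valued.v (e : (w₁ : HeightOneSpectrum (𝓞 E)).adicCompletion E) < 1 := by
    rw [HeightOneSpectrum.valuedAdicCompletion_eq_valuation', he, HeightOneSpectrum.valuation_of_algebraMap]
    exact ((w₁ : HeightOneSpectrum (𝓞 E)).intValuation_lt_one_iff_mem r).mpr hr₁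
  have hv₂ : Valued.v (e : (w₂ : HeightOneSpectrum (𝓞 E)).adicCompletion E) = 1 := by
    rw [HeightOneSpectrum.valuedAdicCompletion_eq_valuation', he, HeightOneSpectrum.valuation_of_algebraMap]
    exact le_antisymm ((w₂ : HeightOneSpectrum (𝓞 E)).intValuation_le_one r)
      (not_lt.mp fun h => hr₂ (((w₂ : HeightOneSpectrum (𝓞 E)).intValuation_lt_one_iff_mem r).mp h))
  -- normed structures
  letI : NontriviallyNormedField (v.adicCompletion K) :=
    Valued.toNontriviallyNormedField (v.adicCompletion K) (WithZero (Multiplicative ℤ))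
  letI h₁ : NormedField ((w₁ : HeightOneSpectrum (𝓞 E)).adicCompletion E) :=
    Valued.toNormedField ((w₁ : HeightOneSpectrum (𝓞 E)).adicCompletion E) (WithZero (Multiplicative ℤ))
  letI h₂ : NormedField ((w₂ : HeightOneSpectrum (𝓞 E)).adicCompletion E) :=
    Valued.toNormedField ((w₂ : HeightOneSpectrum (𝓞 E)).adicCompletion E) (WithZero (Multiplicative ℤ))
  have hcont : Continuous Θ := by
    haveI := finiteDimensional_place (v := v) w₁
    haveI : ContinuousSMul (v.adicCompletion K) ((w₁ : HeightOneSpectrum (𝓞 E)).adicCompletion E) :=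
      continuousSMul_of_algebraMap _ _
        (continuous_adicCompletionOfLiesOver K E v (w₁ : HeightOneSpectrum (𝓞 E)))
    haveI : ContinuousSMul (v.adicCompletion K) ((w₂ : HeightOneSpectrum (𝓞 E)).adicCompletion E) :=
      continuousSMul_of_algebraMap _ _
        (continuous_adicCompletionOfLiesOver K E v (w₂ : HeightOneSpectrum (𝓞 E)))
    exact LinearMap.continuous_of_finiteDimensional Θ.toLinearMap
  -- `eᵏ → 0` in `E_{w₁}`, so `Θ(eᵏ) = eᵏ → 0` in `E_{w₂}`
  have hlim₁ : Filter.Tendsto (fun k : ℕ => (e : (w₁ : HeightOneSpectrum (𝓞 E)).adicCompletion E) ^ k)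
      Filter.atTop (nhds 0) :=
    tendsto_pow_atTop_nhds_zero_of_norm_lt_one ((Valued.toNormedField.norm_lt_one_iff).mpr hv₁)
  have hlim₂ : Filter.Tendsto (fun k : ℕ => (e : (w₂ : HeightOneSpectrum (𝓞 E)).adicCompletion E) ^ k)
      Filter.atTop (nhds 0) := by
    have := (hcont.tendsto 0).comp hlim₁
    rw [map_zero] at this
    refine this.congr fun k => ?_
    simp only [Function.comp_apply, map_pow, hΘ]
  -- but `‖eᵏ‖ = 1` in `E_{w₂}`
  have hnorm : ∀ k : ℕ, ‖(e : (w₂ : HeightOneSpectrum (𝓞 E)).adicCompletion E) ^ k‖ = 1 := fun k => by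
    have h1 : ‖(e : (w₂ : HeightOneSpectrum (𝓞 E)).adicCompletion E)‖ = 1 :=
      le_antisymm (Valued.toNormedField.norm_le_one_iff.mpr hv₂.le)
        (Valued.toNormedField.one_le_norm_iff.mpr hv₂.ge)
    rw [norm_pow, h1, one_pow]
  have h0 : ‖(0 : (w₂ : HeightOneSpectrum (𝓞 E)).adicCompletion E)‖ = 1 := by
    have hc := (continuous_norm.tendsto _).comp hlim₂
    have hconst : (fun k : ℕ => ‖(e : (w₂ : HeightOneSpectrum (𝓞 E)).adicCompletion E) ^ k‖) =
        fun _ => (1 : ℝ) := funext hnorm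
    rw [show ((fun x => ‖x‖) ∘ fun k : ℕ => (e : (w₂ : HeightOneSpectrum (𝓞 E)).adicCompletion E) ^ k) =
        fun _ => (1 : ℝ) from hconst] at hc
    exact tendsto_nhds_unique hc tendsto_const_nhds
  rw [norm_zero] at h0
  exact zero_ne_one h0

end Rigidity

/-! ### The compositum `E·K_v ⊆ K̄_v` and the place it defines -/

section Compositum

variable (v) [IsGalois K E] (ιE : E →ₐ[K] AlgebraicClosure K)


omit [NumberField E] [IsGalois K E] in
/-- The image of `e ∈ E` in `K̄_v` (along `ιE : E → K̄` and the chosen `K̄ → K̄_v`) lies in the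
compositum `K_v(E) ⊆ K̄_v`. [folklore] -/
theorem mem_compositum (e : E) :
    (absClosureEmbedding K (v.adicCompletion K)).comp ιE e ∈
      IntermediateField.adjoin (v.adicCompletion K)
        (Set.range ((absClosureEmbedding K (v.adicCompletion K)).comp ιE)) :=
  IntermediateField.subset_adjoin _ _ ⟨e, rfl⟩

/-- **Some completion `E_w` realises the compositum**: for the generator `α` of a power basis of
`E/K`, the minimal polynomial over `K_v` of the image of `α` in `K̄_v` has the root `α ∈ E_{w₀}` for
some place `w₀ ∣ v`.  (Otherwise the complementary factor `g` of `minpoly_K α = m · g` over `K_v`,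
of degree `< [E:K]`, would kill `α` in every `E_w`, i.e. `g(diag α) = 0` in `∏_w E_w`, contradicting
the `K_v`-linear independence of `diag(αⁱ)`, `i < [E:K]`.) [cite: CasselsFrohlichANT1967, Ch. II §10] -/
theorem exists_place_aeval_minpoly_eq_zero :
    ∃ w : Place K E v,
      aeval (algebraMap E ((w : HeightOneSpectrum (𝓞 E)).adicCompletion E)
          (Field.powerBasisOfFiniteOfSeparable K E).gen)
        (minpoly (v.adicCompletion K)
          ((absClosureEmbedding K (v.adicCompletion K)).comp ιE
            (Field.powerBasisOfFiniteOfSeparable K E).gen)) = 0 := by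
  classical
  set pb := Field.powerBasisOfFiniteOfSeparable K E with hpb
  set α : E := pb.gen with hα
  set jv := (absClosureEmbedding K (v.adicCompletion K)).comp ιE with hjv
  set β : AlgebraicClosure (v.adicCompletion K) := jv α with hβ
  have hβint : IsIntegral (v.adicCompletion K) β := Algebra.IsIntegral.isIntegral β
  set f : K[X] := minpoly K α with hf
  set m : (v.adicCompletion K)[X] := minpoly (v.adicCompletion K) β with hm
  set n : ℕ := pb.dim with hn
  have hfdeg : f.natDegree = n := pb.natDegree_minpoly
  -- `m ∣ f` over `K_v`
  have hroot : aeval β (f.map (algebraMap K (v.adicCompletion K))) = 0 := by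
    rw [aeval_map_algebraMap, hβ, aeval_algHom_apply, hf, minpoly.aeval, map_zero]
  obtain ⟨g, hg⟩ := minpoly.dvd (v.adicCompletion K) β hroot
  by_contra hall
  push Not at hall
  -- `g` kills `α` in every `E_w`
  have hgw : ∀ w : Place K E v,
      aeval (algebraMap E ((w : HeightOneSpectrum (𝓞 E)).adicCompletion E) α) g = 0 := by
    intro w
    haveI := isScalarTower_place (v := v) w
    have h0 : aeval (algebraMap E ((w : HeightOneSpectrum (𝓞 E)).adicCompletion E) α)
        (f.map (algebraMap K (v.adicCompletion K))) = 0 := by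
      rw [aeval_map_algebraMap, aeval_algebraMap_apply, hf, minpoly.aeval, map_zero]
    rw [hg, map_mul] at h0
    exact (mul_eq_zero.mp h0).resolve_left (hall w)
  -- hence `g(diag α) = 0` in `∏_w E_w`
  have hgd : aeval (diag K E v α) g = 0 := by
    funext w
    rw [Pi.zero_apply,
      show aeval (diag K E v α) g w = Pi.evalAlgHom (v.adicCompletion K)
        (fun w : Place K E v => (w : HeightOneSpectrum (𝓞 E)).adicCompletion E) w
          (aeval (diag K E v α) g) from rfl, ← aeval_algHom_apply]
    exact hgw w
  -- degrees: `g ≠ 0`, `deg g < n`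
  have hf0 : f.map (algebraMap K (v.adicCompletion K)) ≠ 0 :=
    Polynomial.map_ne_zero (minpoly.ne_zero pb.isIntegral_gen)
  have hm0 : m ≠ 0 := minpoly.ne_zero hβint
  have hg0 : g ≠ 0 := by
    rintro rfl
    rw [mul_zero] at hg
    exact hf0 hg
  have hgdeg : g.natDegree < n := by
    have h1 : (f.map (algebraMap K (v.adicCompletion K))).natDegree = m.natDegree + g.natDegree := by
      rw [hg, natDegree_mul hm0 hg0]
    rw [natDegree_map, hfdeg] at h1
    have h2 : 0 < m.natDegree := minpoly.natDegree_pos hβint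
    omega
  -- expand `g(diag α)` on the `K_v`-basis `diag(αⁱ)`, `i < n`
  have hsum : ∑ i : Fin n, g.coeff i • diag K E v (pb.basis i) = 0 := by
    rw [← hgd, aeval_eq_sum_range' hgdeg,
      ← Fin.sum_univ_eq_sum_range (fun i => g.coeff i • diag K E v α ^ i) n]
    refine Finset.sum_congr rfl fun i _ => ?_
    rw [pb.coe_basis, map_pow]
  have hli := linearIndependent_diag_comp_basis (v := v) pb.basis
  rw [Fintype.linearIndependent_iff] at hli
  have hcoeff : ∀ i : Fin n, g.coeff i = 0 := hli _ hsum
  apply hg0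
  refine Polynomial.ext fun i => ?_
  rw [coeff_zero]
  by_cases hi : i < n
  · exact hcoeff ⟨i, hi⟩
  · exact coeff_eq_zero_of_natDegree_lt (by omega)

/-- **The compositum `K_v(E) ⊆ K̄_v` is `K_v`-isomorphic to a completion `E_{w₀}` over `E`**
(existence): there are a place `w₀ ∣ v` and a `K_v`-algebra homomorphism `θ : K_v(E) → E_{w₀}`
with `θ(e) = e` for `e ∈ E` (Cassels–Fröhlich II §10: `E ⊗_K K_v ≅ ∏_{w∣v} E_w`, the factor
through which the embedding `E ⊗ K_v → K̄_v` factors). [cite: CasselsFrohlichANT1967, Ch. II §10] -/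
theorem exists_place_algHom_compositum :
    ∃ (w : Place K E v)
      (θ : IntermediateField.adjoin (v.adicCompletion K)
          (Set.range ((absClosureEmbedding K (v.adicCompletion K)).comp ιE)) →ₐ[v.adicCompletion K]
        (w : HeightOneSpectrum (𝓞 E)).adicCompletion E),
      ∀ e : E, θ ⟨(absClosureEmbedding K (v.adicCompletion K)).comp ιE e, mem_compositum v ιE e⟩ =
        algebraMap E _ e := by
  classical
  obtain ⟨w, hw⟩ := exists_place_aeval_minpoly_eq_zero v ιE
  haveI := isScalarTower_place (v := v) w
  set pb := Field.powerBasisOfFiniteOfSeparable K E with hpb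
  set α : E := pb.gen with hα
  set jv := (absClosureEmbedding K (v.adicCompletion K)).comp ιE with hjv
  set β : AlgebraicClosure (v.adicCompletion K) := jv α with hβ
  have hβint : IsIntegral (v.adicCompletion K) β := Algebra.IsIntegral.isIntegral β
  set αw := algebraMap E ((w : HeightOneSpectrum (𝓞 E)).adicCompletion E) α with hαw
  have hmem : αw ∈ (minpoly (v.adicCompletion K) β).aroots
      ((w : HeightOneSpectrum (𝓞 E)).adicCompletion E) := by
    rw [mem_aroots]
    exact ⟨minpoly.ne_zero hβint, hw⟩
  set θ₀ : (v.adicCompletion K)⟮β⟯ →ₐ[v.adicCompletion K]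
      (w : HeightOneSpectrum (𝓞 E)).adicCompletion E :=
    (algHomAdjoinIntegralEquiv (v.adicCompletion K) hβint).symm ⟨αw, hmem⟩ with hθ₀
  have hθ₀gen : θ₀ (AdjoinSimple.gen (v.adicCompletion K) β) = αw :=
    algHomAdjoinIntegralEquiv_symm_apply_gen (v.adicCompletion K) hβint ⟨αw, hmem⟩
  -- every element of `E` is a polynomial in `α`, so `jv(E) ⊆ K_v⟮β⟯`
  have hpoly : ∀ e : E, ∃ p : K[X], e = aeval α p := fun e => by
    obtain ⟨p, -, hp⟩ := pb.exists_eq_aeval e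
    exact ⟨p, hp⟩
  have hcoe : ∀ p : (v.adicCompletion K)[X],
      ((aeval (AdjoinSimple.gen (v.adicCompletion K) β) p : (v.adicCompletion K)⟮β⟯) :
        AlgebraicClosure (v.adicCompletion K)) = aeval β p := fun p => by
    rw [← AdjoinSimple.algebraMap_gen (v.adicCompletion K) β]
    exact (aeval_algHom_apply ((v.adicCompletion K)⟮β⟯).val _ p).symm
  have hjve : ∀ (e : E) (p : K[X]), e = aeval α p →
      jv e = aeval β (p.map (algebraMap K (v.adicCompletion K))) := fun e p hp => by
    rw [aeval_map_algebraMap, hp, hβ, aeval_algHom_apply]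
  have hle : IntermediateField.adjoin (v.adicCompletion K) (Set.range jv) ≤ (v.adicCompletion K)⟮β⟯ := by
    rw [IntermediateField.adjoin_le_iff]
    rintro _ ⟨e, rfl⟩
    obtain ⟨p, hp⟩ := hpoly e
    rw [SetLike.mem_coe, hjve e p hp, ← hcoe]
    exact SetLike.coe_mem _
  refine ⟨w, θ₀.comp (IntermediateField.inclusion hle), fun e => ?_⟩
  obtain ⟨p, hp⟩ := hpoly e
  have helt : (IntermediateField.inclusion hle ⟨jv e, mem_compositum v ιE e⟩ :
      (v.adicCompletion K)⟮β⟯) =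
      aeval (AdjoinSimple.gen (v.adicCompletion K) β) (p.map (algebraMap K (v.adicCompletion K))) := by
    apply Subtype.ext
    rw [hcoe]
    exact hjve e p hp
  rw [AlgHom.comp_apply, helt, ← aeval_algHom_apply, hθ₀gen, aeval_map_algebraMap, hαw,
    aeval_algebraMap_apply, ← hp]

/-- **Such a `θ` is bijective**: injective as a field homomorphism, surjective because the
`K_v`-span of `E` is all of `E_{w}` (`span_range_coe_eq_top`).  So `K_v(E) ≅ E_{w}` over `K_v`
and over `E`. [cite: CasselsFrohlichANT1967, Ch. II §10] -/
theorem bijective_algHom_compositum {w : Place K E v}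
    (θ : IntermediateField.adjoin (v.adicCompletion K)
        (Set.range ((absClosureEmbedding K (v.adicCompletion K)).comp ιE)) →ₐ[v.adicCompletion K]
      (w : HeightOneSpectrum (𝓞 E)).adicCompletion E)
    (hθ : ∀ e : E, θ ⟨(absClosureEmbedding K (v.adicCompletion K)).comp ιE e, mem_compositum v ιE e⟩ =
      algebraMap E _ e) :
    Function.Bijective θ := by
  refine ⟨θ.toRingHom.injective, ?_⟩
  have hs : Function.Surjective θ.toLinearMap := by
    rw [← LinearMap.range_eq_top, eq_top_iff, ← span_range_coe_eq_top w, Submodule.span_le]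
    rintro _ ⟨e, rfl⟩
    exact ⟨⟨_, mem_compositum v ιE e⟩, hθ e⟩
  exact hs

/-- The local degree is the degree of the compositum: `[K_v(E) : K_v] = [E_w : K_v]`. [folklore] -/
theorem finrank_compositum_eq {w : Place K E v}
    (θ : IntermediateField.adjoin (v.adicCompletion K)
        (Set.range ((absClosureEmbedding K (v.adicCompletion K)).comp ιE)) →ₐ[v.adicCompletion K]
      (w : HeightOneSpectrum (𝓞 E)).adicCompletion E)
    (hθ : ∀ e : E, θ ⟨(absClosureEmbedding K (v.adicCompletion K)).comp ιE e, mem_compositum v ιE e⟩ =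
      algebraMap E _ e) :
    Module.finrank (v.adicCompletion K)
        (IntermediateField.adjoin (v.adicCompletion K)
          (Set.range ((absClosureEmbedding K (v.adicCompletion K)).comp ιE))) =
      Module.finrank (v.adicCompletion K) ((w : HeightOneSpectrum (𝓞 E)).adicCompletion E) :=
  (LinearEquiv.ofBijective θ.toLinearMap (bijective_algHom_compositum v ιE θ hθ)).finrank_eq

/-! ### The action of `Γ_{K_v}`: restriction to `E`, equivariance of `θ`, the decomposition group -/

omit [NumberField E] in
/-- **Restriction of `d ∈ Γ_{K_v}` to `E`**: there is `g ∈ Gal(E/K)` with `ιE ∘ g = d|_{K̄} ∘ ιE`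
(`E/K` is normal, so `d|_{K̄} = absGaloisRestrict K K_v d` preserves `ιE(E)`). [folklore] -/
theorem exists_restrict (d : Field.absoluteGaloisGroup (v.adicCompletion K)) :
    ∃ g : E ≃ₐ[K] E, ∀ e : E, ιE (g e) = absGaloisRestrict K (v.adicCompletion K) d • ιE e := by
  letI : Algebra E (AlgebraicClosure K) := ιE.toRingHom.toAlgebra
  haveI : IsScalarTower K E (AlgebraicClosure K) :=
    IsScalarTower.of_algebraMap_eq fun x => (ιE.commutes x).symm
  refine ⟨(absGaloisRestrict K (v.adicCompletion K) d).restrictNormal E, fun e => ?_⟩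
  exact AlgEquiv.restrictNormal_commutes (absGaloisRestrict K (v.adicCompletion K) d) E e

omit [NumberField E] [IsGalois K E] in
/-- The restriction is unique. [folklore] -/
theorem restrict_unique {d : Field.absoluteGaloisGroup (v.adicCompletion K)} {g g' : E ≃ₐ[K] E}
    (hg : ∀ e : E, ιE (g e) = absGaloisRestrict K (v.adicCompletion K) d • ιE e)
    (hg' : ∀ e : E, ιE (g' e) = absGaloisRestrict K (v.adicCompletion K) d • ιE e) : g = g' :=
  AlgEquiv.ext fun e => ιE.toRingHom.injective ((hg e).trans (hg' e).symm)

omit [NumberField E] [IsGalois K E] in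
/-- Restrictions multiply. [folklore] -/
theorem restrict_mul {d d' : Field.absoluteGaloisGroup (v.adicCompletion K)} {g g' : E ≃ₐ[K] E}
    (hg : ∀ e : E, ιE (g e) = absGaloisRestrict K (v.adicCompletion K) d • ιE e)
    (hg' : ∀ e : E, ιE (g' e) = absGaloisRestrict K (v.adicCompletion K) d' • ιE e) (e : E) :
    ιE ((g * g') e) = absGaloisRestrict K (v.adicCompletion K) (d * d') • ιE e := by
  rw [AlgEquiv.mul_apply, hg, hg', map_mul, mul_smul]

omit [NumberField E] [IsGalois K E] in
/-- Restriction of the inverse. [folklore] -/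
theorem restrict_inv {d : Field.absoluteGaloisGroup (v.adicCompletion K)} {g : E ≃ₐ[K] E}
    (hg : ∀ e : E, ιE (g e) = absGaloisRestrict K (v.adicCompletion K) d • ιE e) (e : E) :
    ιE (g⁻¹ e) = absGaloisRestrict K (v.adicCompletion K) d⁻¹ • ιE e := by
  rw [map_inv, eq_inv_smul_iff, ← hg, show g (g⁻¹ e) = e from g.apply_symm_apply e]

omit [NumberField E] [IsGalois K E] in
/-- **`d` acts on the image of `E` in `K̄_v` through its restriction**: `d • e = g e`. [folklore] -/
theorem smul_comp_apply {d : Field.absoluteGaloisGroup (v.adicCompletion K)} {g : E ≃ₐ[K] E}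
    (hg : ∀ e : E, ιE (g e) = absGaloisRestrict K (v.adicCompletion K) d • ιE e) (e : E) :
    d • (absClosureEmbedding K (v.adicCompletion K)).comp ιE e =
      (absClosureEmbedding K (v.adicCompletion K)).comp ιE (g e) := by
  rw [AlgHom.comp_apply, AlgHom.comp_apply, hg, absGaloisRestrict_apply_smul]

omit [NumberField E] [IsGalois K E] in
/-- The compositum `K_v(E)` is stable under `Γ_{K_v}`. [folklore] -/
theorem smul_mem_compositum {d : Field.absoluteGaloisGroup (v.adicCompletion K)} {g : E ≃ₐ[K] E}
    (hg : ∀ e : E, ιE (g e) = absGaloisRestrict K (v.adicCompletion K) d • ιE e)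
    {x : AlgebraicClosure (v.adicCompletion K)}
    (hx : x ∈ IntermediateField.adjoin (v.adicCompletion K)
      (Set.range ((absClosureEmbedding K (v.adicCompletion K)).comp ιE))) :
    d • x ∈ IntermediateField.adjoin (v.adicCompletion K)
      (Set.range ((absClosureEmbedding K (v.adicCompletion K)).comp ιE)) := by
  have hmap : (IntermediateField.adjoin (v.adicCompletion K)
      (Set.range ((absClosureEmbedding K (v.adicCompletion K)).comp ιE))).map
        (d : AlgebraicClosure (v.adicCompletion K) ≃ₐ[v.adicCompletion K]
          AlgebraicClosure (v.adicCompletion K)).toAlgHom ≤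
      IntermediateField.adjoin (v.adicCompletion K)
        (Set.range ((absClosureEmbedding K (v.adicCompletion K)).comp ιE)) := by
    rw [IntermediateField.adjoin_map, IntermediateField.adjoin_le_iff]
    rintro _ ⟨_, ⟨e, rfl⟩, rfl⟩
    change d • (absClosureEmbedding K (v.adicCompletion K)).comp ιE e ∈ _
    rw [smul_comp_apply v ιE hg]
    exact mem_compositum v ιE (g e)
  exact hmap ⟨x, hx, rfl⟩

/-- **`Γ_{K_v}` maps into the decomposition group**: if `θ : K_v(E) ≅ E_w` over `E` exists and `g`
is the restriction of `d ∈ Γ_{K_v}`, then `g` fixes the place `w` (rigidity applied to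
`g_* ∘ θ ∘ d⁻¹ ∘ θ⁻¹ : E_w → E_{g w}`, which is the identity on `E`).
[cite: CasselsFrohlichANT1967, Ch. VII §1.1] -/
theorem smul_place_eq {w : Place K E v}
    (θ : IntermediateField.adjoin (v.adicCompletion K)
        (Set.range ((absClosureEmbedding K (v.adicCompletion K)).comp ιE)) →ₐ[v.adicCompletion K]
      (w : HeightOneSpectrum (𝓞 E)).adicCompletion E)
    (hθ : ∀ e : E, θ ⟨(absClosureEmbedding K (v.adicCompletion K)).comp ιE e, mem_compositum v ιE e⟩ =
      algebraMap E _ e)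
    {d : Field.absoluteGaloisGroup (v.adicCompletion K)} {g : E ≃ₐ[K] E}
    (hg : ∀ e : E, ιE (g e) = absGaloisRestrict K (v.adicCompletion K) d • ιE e) : g • w = w := by
  have hg' := restrict_inv v ιE hg
  -- `θ' = g_* ∘ θ ∘ d⁻¹ : (IntermediateField.adjoin (v.adicCompletion K) (Set.range ((absClosureEmbedding K (v.adicCompletion K)).comp ιE))) → E_{g w}`
  let θ'fun : (IntermediateField.adjoin (v.adicCompletion K) (Set.range ((absClosureEmbedding K (v.adicCompletion K)).comp ιE))) → ((g • w : Place K E v) : HeightOneSpectrum (𝓞 E)).adicCompletion E := fun x =>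
    galAdicCompletionMap g (Place.smul_coe g w) (θ ⟨d⁻¹ • (x : AlgebraicClosure (v.adicCompletion K)),
      smul_mem_compositum v ιE hg' x.2⟩)
  have hθ'mul : ∀ x y : (IntermediateField.adjoin (v.adicCompletion K) (Set.range ((absClosureEmbedding K (v.adicCompletion K)).comp ιE))), θ'fun (x * y) = θ'fun x * θ'fun y := fun x y => by
    simp only [θ'fun, ← map_mul]
    congr 2
    exact Subtype.ext (smul_mul' d⁻¹ (x : AlgebraicClosure (v.adicCompletion K)) y)
  have hθ'add : ∀ x y : (IntermediateField.adjoin (v.adicCompletion K) (Set.range ((absClosureEmbedding K (v.adicCompletion K)).comp ιE))), θ'fun (x + y) = θ'fun x + θ'fun y := fun x y => by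
    simp only [θ'fun, ← map_add]
    congr 2
    exact Subtype.ext (smul_add d⁻¹ (x : AlgebraicClosure (v.adicCompletion K)) y)
  have hθ'alg : ∀ c : v.adicCompletion K, θ'fun (algebraMap _ (IntermediateField.adjoin (v.adicCompletion K) (Set.range ((absClosureEmbedding K (v.adicCompletion K)).comp ιE))) c) = algebraMap _ _ c := fun c => by
    simp only [θ'fun]
    have h1 : (⟨d⁻¹ • ((algebraMap (v.adicCompletion K) (IntermediateField.adjoin (v.adicCompletion K) (Set.range ((absClosureEmbedding K (v.adicCompletion K)).comp ιE))) c : (IntermediateField.adjoin (v.adicCompletion K) (Set.range ((absClosureEmbedding K (v.adicCompletion K)).comp ιE)))) : AlgebraicClosure (v.adicCompletion K)),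
        smul_mem_compositum v ιE hg' (algebraMap (v.adicCompletion K) (IntermediateField.adjoin (v.adicCompletion K) (Set.range ((absClosureEmbedding K (v.adicCompletion K)).comp ιE))) c).2⟩ : (IntermediateField.adjoin (v.adicCompletion K) (Set.range ((absClosureEmbedding K (v.adicCompletion K)).comp ιE)))) =
        algebraMap (v.adicCompletion K) (IntermediateField.adjoin (v.adicCompletion K) (Set.range ((absClosureEmbedding K (v.adicCompletion K)).comp ιE))) c :=
      Subtype.ext (AlgEquiv.commutes d⁻¹ c)
    rw [h1, AlgHom.commutes, algebraMap_place_eq, algebraMap_place_eq]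
    exact galAdicCompletionMap_adicCompletionOfLiesOver K g v (Place.smul_coe g w) c
  let θ' : (IntermediateField.adjoin (v.adicCompletion K) (Set.range ((absClosureEmbedding K (v.adicCompletion K)).comp ιE))) →ₐ[v.adicCompletion K] ((g • w : Place K E v) : HeightOneSpectrum (𝓞 E)).adicCompletion E :=
    { toFun := θ'fun
      map_one' := by
        have := hθ'alg 1
        rwa [map_one, map_one] at this
      map_mul' := hθ'mul
      map_zero' := by
        have := hθ'alg 0
        rwa [map_zero, map_zero] at this
      map_add' := hθ'add
      commutes' := hθ'alg }
  have hθ'E : ∀ e : E, θ' ⟨(absClosureEmbedding K (v.adicCompletion K)).comp ιE e,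
      mem_compositum v ιE e⟩ = algebraMap E _ e := fun e => by
    change galAdicCompletionMap g (Place.smul_coe g w) (θ ⟨d⁻¹ • _, _⟩) = _
    have h1 : (⟨d⁻¹ • (absClosureEmbedding K (v.adicCompletion K)).comp ιE e,
        smul_mem_compositum v ιE hg' (mem_compositum v ιE e)⟩ : (IntermediateField.adjoin (v.adicCompletion K) (Set.range ((absClosureEmbedding K (v.adicCompletion K)).comp ιE)))) =
        ⟨(absClosureEmbedding K (v.adicCompletion K)).comp ιE (g⁻¹ e), mem_compositum v ιE (g⁻¹ e)⟩ :=
      Subtype.ext (smul_comp_apply v ιE hg' e)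
    rw [h1, hθ, show algebraMap E ((w : HeightOneSpectrum (𝓞 E)).adicCompletion E) (g⁻¹ e) =
      ((g⁻¹ e : E) : (w : HeightOneSpectrum (𝓞 E)).adicCompletion E) from rfl,
      galAdicCompletionMap_coe_algEquiv K g (Place.smul_coe g w) (g⁻¹ e)]
    rw [show g (g⁻¹ e) = e from g.apply_symm_apply e]
    rfl
  -- `Θ = θ' ∘ θ⁻¹ : E_w → E_{g w}` is the identity on `E`
  set θe := AlgEquiv.ofBijective θ (bijective_algHom_compositum v ιE θ hθ) with hθe
  have hΘ : ∀ e : E, (θ'.comp (θe.symm : _ →ₐ[v.adicCompletion K] (IntermediateField.adjoin (v.adicCompletion K) (Set.range ((absClosureEmbedding K (v.adicCompletion K)).comp ιE)))))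
      (algebraMap E ((w : HeightOneSpectrum (𝓞 E)).adicCompletion E) e) = algebraMap E _ e := by
    intro e
    rw [AlgHom.comp_apply]
    have h1 : (θe.symm : _ →ₐ[v.adicCompletion K] (IntermediateField.adjoin (v.adicCompletion K) (Set.range ((absClosureEmbedding K (v.adicCompletion K)).comp ιE))))
        (algebraMap E ((w : HeightOneSpectrum (𝓞 E)).adicCompletion E) e) =
        ⟨(absClosureEmbedding K (v.adicCompletion K)).comp ιE e, mem_compositum v ιE e⟩ := by
      rw [AlgEquiv.coe_toAlgHom, AlgEquiv.symm_apply_eq]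
      exact (hθ e).symm
    rw [h1, hθ'E]
  exact (place_eq_of_algHom _ hΘ).symm

omit [IsGalois K E] in
/-- **Equivariance of `θ`**: `θ(d • x) = g_* (θ x)` for `x ∈ K_v(E)`, `g` the restriction of `d`
(both sides are `K_v`-algebra maps `K_v(E) → E_w` agreeing on `E`).
[cite: CasselsFrohlichANT1967, Ch. VII §1.1] -/
theorem algHom_compositum_smul {w : Place K E v}
    (θ : IntermediateField.adjoin (v.adicCompletion K)
        (Set.range ((absClosureEmbedding K (v.adicCompletion K)).comp ιE)) →ₐ[v.adicCompletion K]
      (w : HeightOneSpectrum (𝓞 E)).adicCompletion E)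
    (hθ : ∀ e : E, θ ⟨(absClosureEmbedding K (v.adicCompletion K)).comp ιE e, mem_compositum v ιE e⟩ =
      algebraMap E _ e)
    {d : Field.absoluteGaloisGroup (v.adicCompletion K)} {g : E ≃ₐ[K] E}
    (hg : ∀ e : E, ιE (g e) = absGaloisRestrict K (v.adicCompletion K) d • ιE e)
    (h : g • (w : HeightOneSpectrum (𝓞 E)) = w)
    (x : AlgebraicClosure (v.adicCompletion K))
    (hx : x ∈ IntermediateField.adjoin (v.adicCompletion K)
      (Set.range ((absClosureEmbedding K (v.adicCompletion K)).comp ιE))) :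
    θ ⟨d • x, smul_mem_compositum v ιE hg hx⟩ = galAdicCompletionMap g h (θ ⟨x, hx⟩) := by
  -- the two `K_v`-algebra maps `(IntermediateField.adjoin (v.adicCompletion K) (Set.range ((absClosureEmbedding K (v.adicCompletion K)).comp ιE))) → E_w`
  let L : (IntermediateField.adjoin (v.adicCompletion K) (Set.range ((absClosureEmbedding K (v.adicCompletion K)).comp ιE))) →ₐ[v.adicCompletion K] (w : HeightOneSpectrum (𝓞 E)).adicCompletion E :=
    { toFun := fun x => θ ⟨d • (x : AlgebraicClosure (v.adicCompletion K)), smul_mem_compositum v ιE hg x.2⟩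
      map_one' := by
        have h1 : (⟨d • ((1 : (IntermediateField.adjoin (v.adicCompletion K) (Set.range ((absClosureEmbedding K (v.adicCompletion K)).comp ιE)))) : AlgebraicClosure (v.adicCompletion K)),
            smul_mem_compositum v ιE hg (1 : (IntermediateField.adjoin (v.adicCompletion K) (Set.range ((absClosureEmbedding K (v.adicCompletion K)).comp ιE)))).2⟩ : (IntermediateField.adjoin (v.adicCompletion K) (Set.range ((absClosureEmbedding K (v.adicCompletion K)).comp ιE)))) = 1 := Subtype.ext (smul_one d)
        rw [h1, map_one]
      map_mul' := fun x y => by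
        rw [← map_mul]; congr 1
        exact Subtype.ext (smul_mul' d (x : AlgebraicClosure (v.adicCompletion K)) y)
      map_zero' := by
        have h1 : (⟨d • ((0 : (IntermediateField.adjoin (v.adicCompletion K) (Set.range ((absClosureEmbedding K (v.adicCompletion K)).comp ιE)))) : AlgebraicClosure (v.adicCompletion K)),
            smul_mem_compositum v ιE hg (0 : (IntermediateField.adjoin (v.adicCompletion K) (Set.range ((absClosureEmbedding K (v.adicCompletion K)).comp ιE)))).2⟩ : (IntermediateField.adjoin (v.adicCompletion K) (Set.range ((absClosureEmbedding K (v.adicCompletion K)).comp ιE)))) = 0 := Subtype.ext (smul_zero d)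
        rw [h1, map_zero]
      map_add' := fun x y => by
        rw [← map_add]; congr 1
        exact Subtype.ext (smul_add d (x : AlgebraicClosure (v.adicCompletion K)) y)
      commutes' := fun c => by
        have h1 : (⟨d • ((algebraMap (v.adicCompletion K) (IntermediateField.adjoin (v.adicCompletion K) (Set.range ((absClosureEmbedding K (v.adicCompletion K)).comp ιE))) c : (IntermediateField.adjoin (v.adicCompletion K) (Set.range ((absClosureEmbedding K (v.adicCompletion K)).comp ιE)))) : AlgebraicClosure (v.adicCompletion K)),
            smul_mem_compositum v ιE hg (algebraMap (v.adicCompletion K) (IntermediateField.adjoin (v.adicCompletion K) (Set.range ((absClosureEmbedding K (v.adicCompletion K)).comp ιE))) c).2⟩ : (IntermediateField.adjoin (v.adicCompletion K) (Set.range ((absClosureEmbedding K (v.adicCompletion K)).comp ιE)))) =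
            algebraMap (v.adicCompletion K) (IntermediateField.adjoin (v.adicCompletion K) (Set.range ((absClosureEmbedding K (v.adicCompletion K)).comp ιE))) c := Subtype.ext (AlgEquiv.commutes d c)
        rw [h1, AlgHom.commutes] }
  let R : (IntermediateField.adjoin (v.adicCompletion K) (Set.range ((absClosureEmbedding K (v.adicCompletion K)).comp ιE))) →ₐ[v.adicCompletion K] (w : HeightOneSpectrum (𝓞 E)).adicCompletion E :=
    { toRingHom := (galAdicCompletionMap g h).comp θ.toRingHom
      commutes' := fun c => by
        change galAdicCompletionMap g h (θ (algebraMap _ (IntermediateField.adjoin (v.adicCompletion K) (Set.range ((absClosureEmbedding K (v.adicCompletion K)).comp ιE))) c)) = _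
        rw [AlgHom.commutes, algebraMap_place_eq]
        exact galAdicCompletionMap_adicCompletionOfLiesOver K g v h c }
  have hLR : L = R := by
    refine IntermediateField.adjoin_algHom_ext (v.adicCompletion K) fun y hy => ?_
    obtain ⟨e, rfl⟩ := hy
    change θ ⟨d • _, _⟩ = galAdicCompletionMap g h (θ ⟨_, _⟩)
    have h1 : (⟨d • (absClosureEmbedding K (v.adicCompletion K)).comp ιE e,
        smul_mem_compositum v ιE hg (mem_compositum v ιE e)⟩ : (IntermediateField.adjoin (v.adicCompletion K) (Set.range ((absClosureEmbedding K (v.adicCompletion K)).comp ιE)))) =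
        ⟨(absClosureEmbedding K (v.adicCompletion K)).comp ιE (g e), mem_compositum v ιE (g e)⟩ :=
      Subtype.ext (smul_comp_apply v ιE hg e)
    rw [h1, hθ, hθ, show algebraMap E ((w : HeightOneSpectrum (𝓞 E)).adicCompletion E) e =
      ((e : E) : (w : HeightOneSpectrum (𝓞 E)).adicCompletion E) from rfl,
      galAdicCompletionMap_coe_algEquiv K g h e]
    rfl
  exact congrArg (fun φ : (IntermediateField.adjoin (v.adicCompletion K) (Set.range ((absClosureEmbedding K (v.adicCompletion K)).comp ιE))) →ₐ[v.adicCompletion K] _ => φ ⟨x, hx⟩) hLR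

omit [NumberField E] [IsGalois K E] in
/-- **The kernel of the restriction is the group of the compositum**: `d` restricts to the
identity of `E` iff `d ∈ Gal(K̄_v / K_v(E))` (`galFixing`, i.e. `d` fixes `K_v(E)` pointwise). [folklore] -/
theorem restrict_eq_one_iff {d : Field.absoluteGaloisGroup (v.adicCompletion K)} {g : E ≃ₐ[K] E}
    (hg : ∀ e : E, ιE (g e) = absGaloisRestrict K (v.adicCompletion K) d • ιE e) :
    g = 1 ↔ d ∈ LocalWeilDatum.galFixing (v.adicCompletion K)
      (IntermediateField.adjoin (v.adicCompletion K)
        (Set.range ((absClosureEmbedding K (v.adicCompletion K)).comp ιE))) := by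
  rw [LocalWeilDatum.mem_galFixing_iff]
  constructor
  · rintro rfl x hx
    refine LocalWeilDatum.smul_eq_self_of_mem_adjoin (v.adicCompletion K) ?_ hx
    rintro _ ⟨e, rfl⟩
    rw [smul_comp_apply v ιE hg, AlgEquiv.one_apply]
  · intro hd
    refine restrict_unique v ιE hg fun e => ?_
    rw [AlgEquiv.one_apply]
    have h1 : absClosureEmbedding K (v.adicCompletion K) (ιE e) =
        absClosureEmbedding K (v.adicCompletion K) (absGaloisRestrict K (v.adicCompletion K) d • ιE e) := by
      rw [absGaloisRestrict_apply_smul]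
      exact (hd _ (mem_compositum v ιE e)).symm
    exact (absClosureEmbedding K (v.adicCompletion K)).toRingHom.injective h1

/-- **`Γ_{K_v} → G_w` is onto the decomposition group** (`G_w = Stab(w)`, for the place `w` with
`θ : K_v(E) ≅ E_w` over `E`): every `g` fixing `w` is the restriction of some `d ∈ Γ_{K_v}`.  Proof by
counting: the image lies in `G_w` (`smul_place_eq`) and has order `[Γ_{K_v} : Γ_{K_v(E)}] =
[K_v(E) : K_v] = [E_w : K_v] = #G_w` (`finrank_place_eq_card_stabilizer`).
[cite: CasselsFrohlichANT1967, Ch. VII §1.1, Ch. II §10] -/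
theorem exists_restrict_eq_of_smul_place_eq {w : Place K E v}
    (θ : IntermediateField.adjoin (v.adicCompletion K)
        (Set.range ((absClosureEmbedding K (v.adicCompletion K)).comp ιE)) →ₐ[v.adicCompletion K]
      (w : HeightOneSpectrum (𝓞 E)).adicCompletion E)
    (hθ : ∀ e : E, θ ⟨(absClosureEmbedding K (v.adicCompletion K)).comp ιE e, mem_compositum v ιE e⟩ =
      algebraMap E _ e)
    {g : E ≃ₐ[K] E} (hgw : g • w = w) :
    ∃ d : Field.absoluteGaloisGroup (v.adicCompletion K),
      ∀ e : E, ιE (g e) = absGaloisRestrict K (v.adicCompletion K) d • ιE e := by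
  classical
  letI : Algebra E (AlgebraicClosure K) := ιE.toRingHom.toAlgebra
  haveI : IsScalarTower K E (AlgebraicClosure K) :=
    IsScalarTower.of_algebraMap_eq fun x => (ιE.commutes x).symm
  set Φ : Field.absoluteGaloisGroup (v.adicCompletion K) →* (E ≃ₐ[K] E) :=
    (AlgEquiv.restrictNormalHom E).comp (absGaloisRestrict K (v.adicCompletion K)).toMonoidHom with hΦ
  have hΦres : ∀ d e, ιE (Φ d e) = absGaloisRestrict K (v.adicCompletion K) d • ιE e := fun d e =>
    AlgEquiv.restrictNormal_commutes (absGaloisRestrict K (v.adicCompletion K) d) E e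
  -- image ≤ stabiliser
  have hle : Φ.range ≤ MulAction.stabilizer (E ≃ₐ[K] E) w := by
    rintro _ ⟨d, rfl⟩
    exact smul_place_eq v ιE θ hθ (hΦres d)
  -- kernel = fixing group of the compositum
  have hker : Φ.ker = LocalWeilDatum.galFixing (v.adicCompletion K) (IntermediateField.adjoin (v.adicCompletion K) (Set.range ((absClosureEmbedding K (v.adicCompletion K)).comp ιE))) := by
    ext d
    rw [MonoidHom.mem_ker]
    exact restrict_eq_one_iff v ιE (hΦres d)
  -- orders
  haveI : CharZero (v.adicCompletion K) := charZero_of_injective_algebraMap (algebraMap K _).injective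
  haveI : IsGalois (v.adicCompletion K) (AlgebraicClosure (v.adicCompletion K)) := IsGalois.mk
  have hidx : (LocalWeilDatum.galFixing (v.adicCompletion K) (IntermediateField.adjoin (v.adicCompletion K) (Set.range ((absClosureEmbedding K (v.adicCompletion K)).comp ιE)))).index =
      (IntermediateField.fixingSubgroup (IntermediateField.adjoin (v.adicCompletion K) (Set.range ((absClosureEmbedding K (v.adicCompletion K)).comp ιE)))).index :=
    Subgroup.index_comap_of_surjective _
      (Field.absoluteGaloisGroup.toAlgEquiv (v.adicCompletion K)).surjective
  have hcard : Nat.card Φ.range = Nat.card (MulAction.stabilizer (E ≃ₐ[K] E) w) := by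
    rw [← Subgroup.index_ker, hker, hidx, ← IntermediateField.finrank_eq_fixingSubgroup_index,
      finrank_compositum_eq v ιE θ hθ, finrank_place_eq_card_stabilizer]
  have heq : Φ.range = MulAction.stabilizer (E ≃ₐ[K] E) w :=
    Subgroup.eq_of_le_of_card_ge hle hcard.ge
  have hg : g ∈ Φ.range := by rw [heq]; exact hgw
  obtain ⟨d, hd⟩ := hg
  exact ⟨d, fun e => by rw [← hd]; exact hΦres d e⟩

end Compositum



end SemiLocal

end Literature.NumberTheory.GaloisRepresentations
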